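import Summits.ResolutionOfSingularities.ResolutionOfSingularities.Theorems.PurelyInseparableDim4ChartAtlasSNCJacobianCentre
import Summits.ResolutionOfSingularities.ResolutionOfSingularities.Theorems.PurelyInseparableDim4ChartAtlasSNCFarChart
import HarnessLib

/-!
# Purely inseparable four-folds `z^p + F(x₁, …, x₄)`: the REPAIR CENTRE for FAR RESONANCE — `Σ = V(y_0, y_T, y_j)` has simple normal crossings
# with the resonant boundary (S3-N2 repair, far class; cell `res-dim4-pi`, typ-2 g6)

[OURS · counted 0] (D-0157 DOOR 2; DR-157-C; desk WORD #115 (a)/(c), #131 (c); crit-3 g5 K-A3-45 opinion «(b) far-resonance repair»). FAR RESONANCE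
(p699206): on the re-centred `x_j`-chart (escaping case `j ∉ T`) a far hyperplane `{y_j = -c'}` and an active far quadric of the same height make the
escaping centre `Zc = V(y_0, y_T)` NOT snc with the boundary. In the TRANSLATED FRAME `y_j ↦ y_j - c'` (p699206 §1/§2) the members read: the far
hyperplane `y_j·𝒪`, the far quadrics `TQ_k = ((y_k + b_k)·y_j - c'·y_k + e_k)·𝒪` (`e_k = d_k - b_k·c'`; RESONANT iff `e_k = 0`), hyperplanes
`(y_k + a)·𝒪` (near members, the old `E₁ = {y_j = c'}`). The candidate repair (memo `S3-N2-SNC-CRITERION.md` §07:15Z, as Σ for the near class,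
p691715): blow up FIRST the resonance locus `Σ = Zc ∩ {y_j = 0} = V(y_0, y_T, y_j)`. PROVED here (no `sorry`, no new axiom) — step 1 of the repair:

* **`hasSNCWith_𝓘Λ_insert_of_forall_mem_far_translated`** — `Σ` HAS SIMPLE NORMAL CROSSINGS WITH THE WHOLE TRANSLATED BOUNDARY: hyperplanes
  `(k, a) ∈ H` (any finite set; a hyperplane of a quadric's index has the near constant `b_k`), translated far quadrics `TQ_k`, `k ∈ fs ∌ j`, with
  `d_k = e_k + b_k·c' ≠ 0`, ANY number of them resonant — no height condition is needed for `Σ`.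

Method: the Jacobian engine with a general presentation of the centre (p705578 `hasSNCWith_𝓘Λ_of_jacobian_of_span_eq`): `Σ` is presented by
`y_0, y_j, y_t (t ∈ T` non-resonant`)` and the RESONANT QUADRICS themselves (`c'·y_k = (y_k + b_k)·y_j - TQ_k`), every `TQ_k` owning its private
variable `y_k` (`∂TQ_k/∂y_k = y_j - c'`, a unit on `V(TQ_k)` since `TQ_k ≡ d_k` at `y_j = c'`). Step 2 (after `Bl_Σ` the strict transform of `Zc`
misses every resonant member and is snc with the rest) is the next file. Nothing here is a statement about resolution of singularities in dimension
≥ 4 / characteristic `p` (NOT proved anywhere in this programme). bears_on: LADDER-RESOLUTION:D157-DOOR2 (res-dim4-pi). Supports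
stmt-ResolutionOfSingularities-16155 (helper, S3-N2 far repair).
-/

-- every declaration of this summit lives under `Summit.ResolutionOfSingularities.ResolutionOfSingularities`
-- (summit = problem), which the duplicate-namespace linter flags; house convention (cf. the Target file).
set_option linter.dupNamespace false

noncomputable section

open MvPolynomial CategoryTheory AlgebraicGeometry Opposite TopologicalSpace
open AlgebraicGeometry.Scheme.IdealSheafData (ofIdealTop)

namespace Summit.ResolutionOfSingularities.ResolutionOfSingularities.Theorems.PIDim4

open Literature.AlgebraicGeometry.Resolution
open Literature.AlgebraicGeometry.Resolution.AffinePointBlowup (P A γ coord Wtop ξ)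

namespace ChartDictionary

variable {K : Type} [Field K] {T : Finset (Fin 4)} {j : Fin 4} {b e : Fin 4 → K} {c' : K}

/-! ## §1 Bookkeeping: the translated far quadric `TQ_k = (y_k + b_k)·y_j - c'·y_k + e_k` -/

/-- `∂TQ_k/∂y_k = y_j - c'` (`k ≠ j`). -/
theorem pderiv_tquadric_self {k : Fin 4} (hkj : k ≠ j) :
    pderiv k.succ ((X k.succ + C (b k)) * X j.succ - C c' * X k.succ + C (e k) : A 4 K) = X j.succ - C c' := by
  classical
  rw [map_add, pderiv_C, add_zero, map_sub, pderiv_C_mul, pderiv_X_self, mul_one, Derivation.leibniz, smul_eq_mul, smul_eq_mul,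
    pderiv_X_add_C, if_pos rfl, pderiv_X_of_ne (fun h => hkj (Fin.succ_injective _ h).symm), mul_zero, zero_add, mul_one]

/-- `∂TQ_k/∂y_j = y_k + b_k` (`k ≠ j`). -/
theorem pderiv_tquadric_j {k : Fin 4} (hkj : k ≠ j) :
    pderiv j.succ ((X k.succ + C (b k)) * X j.succ - C c' * X k.succ + C (e k) : A 4 K) = X k.succ + C (b k) := by
  classical
  rw [map_add, pderiv_C, add_zero, map_sub, pderiv_C_mul, pderiv_X_of_ne (fun h => hkj (Fin.succ_injective _ h)), mul_zero, sub_zero,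
    Derivation.leibniz, smul_eq_mul, smul_eq_mul, pderiv_X_add_C, if_neg (fun h => hkj (Fin.succ_injective _ h).symm), pderiv_X_self,
    mul_one, mul_zero, add_zero]

/-- `∂TQ_k/∂y_m = 0` for `m ≠ k⁺, j⁺`. -/
theorem pderiv_tquadric_of_ne {k : Fin 4} {m : Fin (4 + 1)} (hmk : m ≠ k.succ) (hmj : m ≠ j.succ) :
    pderiv m ((X k.succ + C (b k)) * X j.succ - C c' * X k.succ + C (e k) : A 4 K) = 0 := by
  classical
  rw [map_add, pderiv_C, add_zero, map_sub, pderiv_C_mul, pderiv_X_of_ne (Ne.symm hmk), mul_zero, sub_zero, Derivation.leibniz,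
    smul_eq_mul, smul_eq_mul, pderiv_X_add_C, if_neg hmk, pderiv_X_of_ne (Ne.symm hmj), mul_zero, mul_zero, add_zero]

/-- `TQ_k` is not a translated hyperplane (`∂²/∂y_k∂y_j = 1`). -/
theorem tquadric_ne_X_add_C {k : Fin 4} (hkj : k ≠ j) (m : Fin (4 + 1)) (a : K) :
    ((X k.succ + C (b k)) * X j.succ - C c' * X k.succ + C (e k) : A 4 K) ≠ X m + C a := by
  intro h
  have h1 := congrArg (fun q : A 4 K => pderiv j.succ (pderiv k.succ q)) h
  simp only [pderiv_tquadric_self hkj, map_sub, pderiv_X_self, pderiv_C, sub_zero, pderiv_X_add_C] at h1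
  by_cases hkm : k.succ = m
  · rw [if_pos hkm, Derivation.map_one_eq_zero] at h1
    exact one_ne_zero h1
  · rw [if_neg hkm, map_zero] at h1
    exact one_ne_zero h1

/-- Translated far quadrics are determined by their index (`k, k' ≠ j`). -/
theorem tquadric_eq_tquadric_iff {k k' : Fin 4} (hkj : k ≠ j) (hk'j : k' ≠ j) :
    ((X k.succ + C (b k)) * X j.succ - C c' * X k.succ + C (e k) : A 4 K) =
      (X k'.succ + C (b k')) * X j.succ - C c' * X k'.succ + C (e k') ↔ k = k' := by
  refine ⟨fun h => ?_, fun hkk => by subst hkk; rfl⟩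
  by_contra hkk
  have h1 := congrArg (fun q : A 4 K => pderiv j.succ (pderiv k.succ q)) h
  simp only [pderiv_tquadric_self hkj, map_sub, pderiv_X_self, pderiv_C, sub_zero,
    pderiv_tquadric_of_ne (fun h => hkk (Fin.succ_injective _ h)) (fun h => hkj (Fin.succ_injective _ h)), map_zero] at h1
  exact one_ne_zero h1

/-- On `V(TQ_k)`: `y_j - c' ∉ 𝔭` (there `TQ_k ≡ d_k = e_k + b_k·c' ≠ 0`). -/
theorem X_sub_C_not_mem_of_tquadric_mem (x : P 4 K) {k : Fin 4} (hd : e k + b k * c' ≠ 0)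
    (hQ : ((X k.succ + C (b k)) * X j.succ - C c' * X k.succ + C (e k) : A 4 K) ∈ x.asIdeal) : (X j.succ - C c' : A 4 K) ∉ x.asIdeal := by
  intro hX
  have h := x.asIdeal.sub_mem hQ (x.asIdeal.mul_mem_left (X k.succ + C (b k)) hX)
  have e1 : ((X k.succ + C (b k)) * X j.succ - C c' * X k.succ + C (e k) - (X k.succ + C (b k)) * (X j.succ - C c') : A 4 K) =
      C (e k + b k * c') := by
    simp only [C_add, C_mul]; ring
  rw [e1, C_mem_asIdeal_iff] at h
  exact hd h

/-- A hyperplane `y_k + b_k` of the quadric's own index never meets `V(TQ_k)`. -/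
theorem X_add_C_not_mem_of_tquadric_mem (x : P 4 K) {k : Fin 4} (hd : e k + b k * c' ≠ 0)
    (hQ : ((X k.succ + C (b k)) * X j.succ - C c' * X k.succ + C (e k) : A 4 K) ∈ x.asIdeal) : (X k.succ + C (b k) : A 4 K) ∉ x.asIdeal := by
  intro hX
  have h := x.asIdeal.sub_mem hQ (x.asIdeal.mul_mem_right (X j.succ) hX)
  have e1 : ((X k.succ + C (b k)) * X j.succ - C c' * X k.succ + C (e k) - (X k.succ + C (b k)) * X j.succ : A 4 K) =
      -(C c') * (X k.succ + C (b k)) + C (e k + b k * c') := by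
    simp only [C_add, C_mul]; ring
  rw [e1] at h
  have h2 := x.asIdeal.sub_mem h (x.asIdeal.mul_mem_left (-(C c')) hX)
  rw [add_sub_cancel_left, C_mem_asIdeal_iff] at h2
  exact hd h2

/-- A RESONANT quadric (`e_k = 0`) through a point of `{y_k = 0} ∩ {y_j = 0}`: no condition; a NON-resonant one never passes through such a point. -/
theorem e_eq_zero_of_tquadric_mem (x : P 4 K) {k : Fin 4}
    (hQ : ((X k.succ + C (b k)) * X j.succ - C c' * X k.succ + C (e k) : A 4 K) ∈ x.asIdeal) (hXk : (X k.succ : A 4 K) ∈ x.asIdeal)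
    (hXj : (X j.succ : A 4 K) ∈ x.asIdeal) : e k = 0 := by
  have h := x.asIdeal.sub_mem (x.asIdeal.sub_mem hQ (x.asIdeal.mul_mem_left (X k.succ + C (b k)) hXj))
    (x.asIdeal.mul_mem_left (-(C c')) hXk)
  have e1 : ((X k.succ + C (b k)) * X j.succ - C c' * X k.succ + C (e k) - (X k.succ + C (b k)) * X j.succ - -C c' * X k.succ : A 4 K) =
      C (e k) := by ring
  rwa [e1, C_mem_asIdeal_iff] at h

/-! ## §2 The repair centre `Σ` is snc with the translated boundary -/

/-- **THE FAR-RESONANCE REPAIR CENTRE `Σ = V(y_0, y_T, y_j)` HAS SIMPLE NORMAL CROSSINGS WITH THE TRANSLATED BOUNDARY** (step 1 of the repair,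
the far analogue of p691715). `j ∉ T`, `c' ≠ 0`; members: `⊤`, hyperplanes `(y_m + a)·𝒪` for `(m, a)` in any finite `H` with `(k⁺, a) ∈ H → a = b_k` for
`k ∈ fs`, and translated far quadrics `TQ_k = ((y_k + b_k)·y_j - c'·y_k + e_k)·𝒪`, `k ∈ fs ∌ j`, `e_k + b_k·c' ≠ 0` (resonant or not). -/
theorem hasSNCWith_𝓘Λ_insert_of_forall_mem_far_translated (hjT : j ∉ T) (hc' : c' ≠ 0) (H : Finset (Fin (4 + 1) × K)) (fs : Finset (Fin 4))
    (hjfs : j ∉ fs) (hd : ∀ k ∈ fs, e k + b k * c' ≠ 0) (hC1 : ∀ k ∈ fs, ∀ a : K, (k.succ, a) ∈ H → a = b k)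
    {E : List (Scheme.IdealSheafData (P 4 K))}
    (hE : ∀ D ∈ E, D = ⊤ ∨ (∃ ma ∈ H, D = ofIdealTop (Ideal.span {(γ 4 K).symm (X ma.1 + C ma.2)})) ∨
      ∃ k ∈ fs, D = ofIdealTop (Ideal.span {(γ 4 K).symm ((X k.succ + C (b k)) * X j.succ - C c' * X k.succ + C (e k))})) :
    HasSNCWith E (AffineCoordBlowup.𝓘Λ 4 K (insert 0 (Fin.succ '' ((insert j T : Finset (Fin 4)) : Set (Fin 4))))) := by
  classical
  set Λ : Set (Fin (4 + 1)) := insert 0 (Fin.succ '' ((insert j T : Finset (Fin 4)) : Set (Fin 4))) with hΛ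
  let hyp : Fin (4 + 1) × K → A 4 K := fun ma => X ma.1 + C ma.2
  let TQ : Fin 4 → A 4 K := fun k => (X k.succ + C (b k)) * X j.succ - C c' * X k.succ + C (e k)
  -- the resonant indices and the presentation of the centre
  let R : Finset (Fin 4) := fs.filter (fun k => k ∈ T ∧ e k = 0)
  let G : Finset (A 4 K) :=
    insert (X 0) (insert (X j.succ) (((T.filter (fun t => t ∉ R)).image fun t => (X t.succ : A 4 K)) ∪ R.image TQ))
  have hR : ∀ k, k ∈ R ↔ k ∈ fs ∧ k ∈ T ∧ e k = 0 := fun k => by simp only [R, Finset.mem_filter]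
  have hGmem : ∀ q, q ∈ G ↔ q = X 0 ∨ q = X j.succ ∨ (∃ t ∈ T, t ∉ R ∧ q = X t.succ) ∨ ∃ k ∈ R, q = TQ k := by
    intro q
    simp only [G, Finset.mem_insert, Finset.mem_union, Finset.mem_image, Finset.mem_filter]
    refine or_congr Iff.rfl (or_congr Iff.rfl (or_congr ?_ ?_))
    · exact ⟨fun ⟨t, ⟨ht, htR⟩, h⟩ => ⟨t, ht, htR, h.symm⟩, fun ⟨t, ht, htR, h⟩ => ⟨t, ⟨ht, htR⟩, h.symm⟩⟩
    · exact ⟨fun ⟨k, hk, h⟩ => ⟨k, hk, h.symm⟩, fun ⟨k, hk, h⟩ => ⟨k, hk, h.symm⟩⟩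
  have hΛmem : ∀ m : Fin (4 + 1), m ∈ Λ ↔ m = 0 ∨ m = j.succ ∨ ∃ t ∈ T, m = t.succ := by
    intro m
    rw [hΛ, Set.mem_insert_iff, Set.mem_image]
    refine or_congr Iff.rfl ⟨?_, ?_⟩
    · rintro ⟨t, ht, rfl⟩
      rcases Finset.mem_insert.mp (Finset.mem_coe.mp ht) with rfl | ht
      · exact Or.inl rfl
      · exact Or.inr ⟨t, ht, rfl⟩
    · rintro (rfl | ⟨t, ht, rfl⟩)
      · exact ⟨j, Finset.mem_coe.mpr (Finset.mem_insert_self _ _), rfl⟩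
      · exact ⟨t, Finset.mem_coe.mpr (Finset.mem_insert_of_mem ht), rfl⟩
  -- `span G = (y_Λ)`
  have hspan : Ideal.span (G : Set (A 4 K)) = Ideal.span (X '' Λ) := by
    apply le_antisymm
    · rw [Ideal.span_le]
      intro q hq
      rcases (hGmem q).mp (Finset.mem_coe.mp hq) with rfl | rfl | ⟨t, ht, -, rfl⟩ | ⟨k, hk, rfl⟩
      · exact Ideal.subset_span ⟨0, (hΛmem 0).mpr (Or.inl rfl), rfl⟩
      · exact Ideal.subset_span ⟨j.succ, (hΛmem _).mpr (Or.inr (Or.inl rfl)), rfl⟩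
      · exact Ideal.subset_span ⟨t.succ, (hΛmem _).mpr (Or.inr (Or.inr ⟨t, ht, rfl⟩)), rfl⟩
      · obtain ⟨-, hkT, hek⟩ := (hR k).mp hk
        have hXk : (X k.succ : A 4 K) ∈ Ideal.span (X '' Λ) := Ideal.subset_span ⟨k.succ, (hΛmem _).mpr (Or.inr (Or.inr ⟨k, hkT, rfl⟩)), rfl⟩
        have hXj : (X j.succ : A 4 K) ∈ Ideal.span (X '' Λ) := Ideal.subset_span ⟨j.succ, (hΛmem _).mpr (Or.inr (Or.inl rfl)), rfl⟩
        change (X k.succ + C (b k)) * X j.succ - C c' * X k.succ + C (e k) ∈ _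
        rw [hek, C_0, add_zero]
        exact Ideal.sub_mem _ (Ideal.mul_mem_left _ _ hXj) (Ideal.mul_mem_left _ _ hXk)
    · rw [Ideal.span_le]
      rintro _ ⟨m, hm, rfl⟩
      have hG0 : (X 0 : A 4 K) ∈ Ideal.span (G : Set (A 4 K)) := Ideal.subset_span (Finset.mem_coe.mpr ((hGmem _).mpr (Or.inl rfl)))
      have hGj : (X j.succ : A 4 K) ∈ Ideal.span (G : Set (A 4 K)) :=
        Ideal.subset_span (Finset.mem_coe.mpr ((hGmem _).mpr (Or.inr (Or.inl rfl))))
      rcases (hΛmem m).mp hm with rfl | rfl | ⟨t, ht, rfl⟩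
      · exact hG0
      · exact hGj
      · by_cases htR : t ∈ R
        · -- a resonant index: `c'·y_t = (y_t + b_t)·y_j - TQ_t`
          obtain ⟨-, -, het⟩ := (hR t).mp htR
          have hTQ : TQ t ∈ Ideal.span (G : Set (A 4 K)) :=
            Ideal.subset_span (Finset.mem_coe.mpr ((hGmem _).mpr (Or.inr (Or.inr (Or.inr ⟨t, htR, rfl⟩)))))
          have h1 : (C c' * X t.succ : A 4 K) ∈ Ideal.span (G : Set (A 4 K)) := by
            have e1 : (C c' * X t.succ : A 4 K) = (X t.succ + C (b t)) * X j.succ - TQ t := by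
              change _ = _ - ((X t.succ + C (b t)) * X j.succ - C c' * X t.succ + C (e t)); rw [het, C_0]; ring
            rw [e1]
            exact Ideal.sub_mem _ (Ideal.mul_mem_left _ _ hGj) hTQ
          have h2 := Ideal.mul_mem_left _ (C c'⁻¹) h1
          rwa [← mul_assoc, ← C_mul, inv_mul_cancel₀ hc', C_1, one_mul] at h2
        · exact Ideal.subset_span (Finset.mem_coe.mpr ((hGmem _).mpr (Or.inr (Or.inr (Or.inl ⟨t, ht, htR, rfl⟩)))))
  -- owners and ranks
  let v : P 4 K → A 4 K → Fin (4 + 1) := fun _ q =>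
    if h : ∃ ma : Fin (4 + 1) × K, q = hyp ma then h.choose.1
    else if h : ∃ k : Fin 4, k ≠ j ∧ q = TQ k then h.choose.succ else 0
  let ρ : P 4 K → A 4 K → ℕ := fun _ q => if ∃ ma : Fin (4 + 1) × K, q = hyp ma then 0 else 1
  have hhyp : ∀ x (m : Fin (4 + 1)) (a : K), v x (X m + C a) = m ∧ ρ x (X m + C a) = 0 := by
    intro x m a
    have h : ∃ ma : Fin (4 + 1) × K, (X m + C a : A 4 K) = hyp ma := ⟨(m, a), rfl⟩
    simp only [v, ρ, dif_pos h, if_pos h, and_true]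
    exact (X_add_C_eq_X_add_C_iff.mp h.choose_spec).1.symm
  have hTQ1 : ∀ k, k ≠ j → ¬ ∃ ma : Fin (4 + 1) × K, TQ k = hyp ma := fun k hkj ⟨ma, h⟩ => tquadric_ne_X_add_C hkj ma.1 ma.2 h
  have hTQ : ∀ x k, k ≠ j → v x (TQ k) = k.succ ∧ ρ x (TQ k) = 1 := by
    intro x k hkj
    have h : ∃ k' : Fin 4, k' ≠ j ∧ TQ k = TQ k' := ⟨k, hkj, rfl⟩
    have hch : h.choose = k := ((tquadric_eq_tquadric_iff hkj h.choose_spec.1).mp h.choose_spec.2).symm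
    simp only [v, ρ, dif_neg (hTQ1 k hkj), if_neg (hTQ1 k hkj), dif_pos h, hch, and_self]
  -- classification of the family
  have hcases : ∀ (x : P 4 K) (q : A 4 K), (q ∈ H.image hyp ∪ fs.image TQ ∧ q ∈ x.asIdeal ∨ q ∈ G ∧ ∀ g ∈ G, g ∈ x.asIdeal) →
      (∃ (m : Fin (4 + 1)) (a : K), q = X m + C a ∧ ((m, a) ∈ H ∨ a = 0)) ∨ ∃ k ∈ fs, q = TQ k := by
    rintro x q (⟨hq, -⟩ | ⟨hq, -⟩)
    · rcases Finset.mem_union.mp hq with hq | hq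
      · obtain ⟨ma, hma, rfl⟩ := Finset.mem_image.mp hq
        exact Or.inl ⟨ma.1, ma.2, rfl, Or.inl hma⟩
      · obtain ⟨k, hk, rfl⟩ := Finset.mem_image.mp hq
        exact Or.inr ⟨k, hk, rfl⟩
    · rcases (hGmem q).mp hq with rfl | rfl | ⟨t, -, -, rfl⟩ | ⟨k, hk, rfl⟩
      · exact Or.inl ⟨0, 0, by rw [C_0, add_zero], Or.inr rfl⟩
      · exact Or.inl ⟨j.succ, 0, by rw [C_0, add_zero], Or.inr rfl⟩
      · exact Or.inl ⟨t.succ, 0, by rw [C_0, add_zero], Or.inr rfl⟩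
      · exact Or.inr ⟨k, ((hR k).mp hk).1, rfl⟩
  have hmem𝔭 : ∀ (x : P 4 K) (q : A 4 K), (q ∈ H.image hyp ∪ fs.image TQ ∧ q ∈ x.asIdeal ∨ q ∈ G ∧ ∀ g ∈ G, g ∈ x.asIdeal) →
      q ∈ x.asIdeal := by
    rintro x q (⟨-, h⟩ | ⟨hq, h⟩); exacts [h, h q hq]
  refine hasSNCWith_𝓘Λ_of_jacobian_of_span_eq E Λ G hspan (H.image hyp ∪ fs.image TQ) ?_ ρ v ?_ ?_
  · intro D hD
    rcases hE D hD with h | ⟨ma, hma, h⟩ | ⟨k, hk, h⟩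
    · exact Or.inl h
    · exact Or.inr ⟨hyp ma, Finset.mem_union_left _ (Finset.mem_image_of_mem _ hma), h⟩
    · exact Or.inr ⟨TQ k, Finset.mem_union_right _ (Finset.mem_image_of_mem _ hk), h⟩
  · -- diagonal
    intro x q hq
    have hq𝔭 := hmem𝔭 x q hq
    rcases hcases x q hq with ⟨m, a, rfl, -⟩ | ⟨k, hk, rfl⟩
    · rw [(hhyp x m a).1, pderiv_X_add_C, if_pos rfl]
      exact fun h1 => x.2.ne_top ((Ideal.eq_top_iff_one _).mpr h1)
    · have hkj : k ≠ j := fun h => hjfs (h ▸ hk)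
      rw [(hTQ x k hkj).1, pderiv_tquadric_self hkj]
      exact X_sub_C_not_mem_of_tquadric_mem x (hd k hk) hq𝔭
  · -- triangularity
    intro x q q' hq hq' hne hρle
    have hq𝔭 := hmem𝔭 x q hq
    have hq'𝔭 := hmem𝔭 x q' hq'
    rcases hcases x q hq with ⟨m, a, rfl, hma⟩ | ⟨k, hk, rfl⟩
    · rw [pderiv_X_add_C]
      rcases hcases x q' hq' with ⟨m', a', rfl, -⟩ | ⟨k', hk', rfl⟩
      · rw [(hhyp x m' a').1]
        by_cases hmm : m' = m
        · subst hmm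
          exact absurd (by rw [X_add_C_eq_of_mem_of_mem x hq𝔭 hq'𝔭]) hne
        · rw [if_neg hmm]; exact x.asIdeal.zero_mem
      · have hk'j : k' ≠ j := fun h => hjfs (h ▸ hk')
        rw [(hTQ x k' hk'j).1]
        by_cases hkm : k'.succ = m
        · -- a hyperplane of the quadric's index: the near member `y_k + b_k` (never meets `TQ_k`), or a variable of `G` (then resonance fails)
          exfalso
          subst hkm
          rcases hma with h | rfl
          · have ha := hC1 k' hk' a h
            subst ha
            exact X_add_C_not_mem_of_tquadric_mem x (hd k' hk') hq'𝔭 hq𝔭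
          · have hX : (X k'.succ : A 4 K) ∈ x.asIdeal := by rwa [C_0, add_zero] at hq𝔭
            rcases hq with ⟨hqΦ, -⟩ | ⟨hqG, hall⟩
            · rcases Finset.mem_union.mp hqΦ with h | h
              · -- the hyperplane `y_k` is a member from `H`: then `b_k = 0` and it is the near member, which misses `TQ_k`
                obtain ⟨ma, hma', hma''⟩ := Finset.mem_image.mp h
                obtain ⟨e1, e2⟩ := X_add_C_eq_X_add_C_iff.mp hma''
                have hb : b k' = 0 := (hC1 k' hk' ma.2 (by rw [← e1]; exact hma')).symm.trans e2
                exact X_add_C_not_mem_of_tquadric_mem x (hd k' hk') hq'𝔭 (by rw [hb]; exact hq𝔭)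
              · obtain ⟨k₀, hk₀, hk₀eq⟩ := Finset.mem_image.mp h
                exact hTQ1 k₀ (fun h => hjfs (h ▸ hk₀)) ⟨(k'.succ, 0), hk₀eq⟩
            · -- the variable `y_k` is a generator of `Σ` in the presentation `G`: then `k ∈ T ∖ R`, but `G ⊆ 𝔭` forces resonance
              have hXj : (X j.succ : A 4 K) ∈ x.asIdeal := hall _ ((hGmem _).mpr (Or.inr (Or.inl rfl)))
              have hek : e k' = 0 := e_eq_zero_of_tquadric_mem x hq'𝔭 hX hXj
              have hq0 : (X k'.succ + C 0 : A 4 K) = X k'.succ := by rw [C_0, add_zero]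
              rw [hq0] at hqG
              rcases (hGmem _).mp hqG with h0 | hj0 | ⟨t, ht, htR, hteq⟩ | ⟨k₀, hk₀, hk₀eq⟩
              · exact Fin.succ_ne_zero k' (X_injective h0)
              · exact hk'j (Fin.succ_injective _ (X_injective hj0))
              · have htk : k' = t := Fin.succ_injective _ (X_injective hteq)
                subst htk
                exact htR ((hR k').mpr ⟨hk', ht, hek⟩)
              · have hk₀fs : k₀ ∈ fs := ((hR k₀).mp hk₀).1
                have hk₀j : k₀ ≠ j := fun h => hjfs (h ▸ hk₀fs)
                have h' : TQ k₀ = hyp (k'.succ, 0) := by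
                  change TQ k₀ = X k'.succ + C 0
                  rw [C_0, add_zero]; exact hk₀eq.symm
                exact hTQ1 k₀ hk₀j ⟨(k'.succ, 0), h'⟩
        · rw [if_neg hkm]; exact x.asIdeal.zero_mem
    · have hkj : k ≠ j := fun h => hjfs (h ▸ hk)
      rcases hcases x q' hq' with ⟨m', a', rfl, -⟩ | ⟨k', hk', rfl⟩
      · exfalso
        rw [(hhyp x m' a').2, (hTQ x k hkj).2] at hρle
        omega
      · have hk'j : k' ≠ j := fun h => hjfs (h ▸ hk')
        have hkk' : k ≠ k' := fun h => hne (by rw [h])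
        rw [(hTQ x k' hk'j).1, pderiv_tquadric_of_ne (fun h => hkk' (Fin.succ_injective _ h).symm) (fun h => hk'j (Fin.succ_injective _ h))]
        exact x.asIdeal.zero_mem

end ChartDictionary

end Summit.ResolutionOfSingularities.ResolutionOfSingularities.Theorems.PIDim4

end
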